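import Literature.Geometry.Symplectic.SurfaceTangentIndexSign
import Literature.Geometry.Symplectic.AlmostComplexTangentSection
import Literature.Geometry.Riemannian.GaussBonnetGradient
import Literature.Geometry.Riemannian.RiemannianMetricExists
import Literature.Topology.FourManifolds.SphereMorseCount
import Literature.Topology.FourManifolds.MorseExistence
import Literature.Topology.FourManifolds.MorseProofs
import Literature.AlgebraicTopology.CharacteristicClasses.TopologicalChernClassesProofs
import Literature.AlgebraicTopology.CharacteristicClasses.WhitneyLineCase
import Literature.AlgebraicTopology.SingularHomology.CompactManifoldFiniteness
import Literature.AlgebraicTopology.SingularHomology.FundamentalClassProofs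
import Literature.AlgebraicTopology.SingularHomology.FundamentalClassExistence
import Literature.AlgebraicTopology.SingularHomology.CellsAttachmentEuler
import Literature.AlgebraicTopology.SingularHomology.EulerCharacteristicTriple
import HarnessLib

/-!
# `⟨c₁(TS, j), [S]⟩ = χ(S) = 2 - b₁(S)` for a closed surface with a tamed almost complex structure

D. McDuff, D. Salamon, *Introduction to Symplectic Topology*, 3rd ed. (2017), Thm. 2.7.1
(normalization axiom "`c₁(TΣ) = 2 - 2g`") with Thm. 2.7.5 (eq. (2.7.1): the first Chern number is the
number of zeros of a transverse section counted with signs): for a closed connected surface `S` with a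
nondegenerate `2`-form `t` and ANY almost complex structure `j` tamed by `t`, the first Chern number of
the complex line bundle `(TS, j)` is the Euler characteristic.  We prove the sign-free form

  `∃ μS, ∀ j tamed by t, ⟨c₁(TS, j), [S]_{μS}⟩ = 2 - rank H₁(S; ℤ)`                    (GB)

(`exists_orientation_kroneckerPairing_chernClass_tangent_eq`), the orientation `μS = ±(area
orientation of t)` being fixed by the tree's normalisation unit `κ(μE) = ±1` of the Thom class /
reference orientation (`lineIndexUnit`), the same for all `S`, `t`, `j`.

## Proof (Poincaré–Hopf, as in McDuff–Salamon Thm. 2.7.5 / Milnor–Stasheff §11–§12)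

* `c₁(L) = -e(L)` for a line bundle (`chernClassR_one_of_rank_one`), so `⟨c₁, [S]_μ⟩ = -⟨e, [S]_μ⟩`.
* Localisation (`kroneckerPairing_eulerClass_fundamentalClass`): for a continuous section `s` with
  finitely many zeros, `⟨e(L), [S]_μ⟩ = Σ_{p ∈ Z(s)} ind_p(s)`.
* The section: `s = β(grad_G f)` for a Riemannian metric `G` and a Morse function `f`
  (`nonempty_contMDiffRiemannianMetric`, `exists_isMorse_holds`, `fieldSection`); its zeros are the
  (finitely many) critical points.
* The local index at a critical point `p` (`localIndex_fieldSection_eq`): by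
  `localIndex_eq_sign_det_mul_lineIndexUnit` it is `sign det(Λ_p L_p) · κ(μR o p)` where `L_p` is the
  linearisation of `grad f` in the chart at `p` (`exists_linearization_grad`:
  `sign det L_p = (-1)^{ind_p f}`), `Λ_p` the tangent plane map (`tangentPlaneMap`) and `μR o p` the
  reference orientation behind the area orientation `μ`; the coherence lemma
  `sign_mul_lineIndexUnit_μR` (`sign det Λ_p` and `κ(μR o p)/κ(μE)` flip together with the orientation
  of the preferred chart at `p`, because `j` is tamed by `t`) turns this into `(-1)^{ind_p f} κ(μE)`.
* Morse count (`morseCount_eq_relEuler`): `Σ_p (-1)^{ind_p f} = χ(S) = 2 - b₁(S)`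
  (`relEuler_surface_eq_two_sub`).  Hence `⟨c₁, [S]_μ⟩ = -κ(μE) χ(S)` and `μS := ∓μ` does it.

Everything is proved; no named facts.

## References

* [McDuffSalamon2017] D. McDuff, D. Salamon, Introduction to Symplectic Topology, 3rd ed., OUP 2017,
  Thm. 2.7.1 (normalization), Thm. 2.7.5 eq. (2.7.1), §2.5 eq. (2.5.3) (tameness).
* [MilnorStasheff1974] J. Milnor, J. Stasheff, Characteristic Classes, §11–§12 (Cor. 11.12).
* [Milnor1963] J. Milnor, Morse Theory, §6.
* [HatcherAT2002] A. Hatcher, Algebraic Topology, Thm. 3.26, Lemma 3.27.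
-/

noncomputable section

open scoped Manifold ContDiff Topology
open Set Function Filter Module Bundle CategoryTheory
open Literature.AlgebraicTopology.SingularHomology Literature.AlgebraicTopology.CharacteristicClasses
open Literature.Topology.FourManifolds Literature.Topology.FourManifolds.HomologicalOrientationOfSmooth
open Literature.Geometry.Kaehler Literature.Geometry.Riemannian Literature.Geometry.Lorentzian
open Literature.Geometry.Lorentzian.PseudoRiemannianMetric
open ComplexVectorBundle

/-- Local notation: `𝔼 n` is the model Euclidean space `EuclideanSpace ℝ (Fin n)`. -/
local notation "𝔼 " n:arg => EuclideanSpace ℝ (Fin n)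

namespace Literature.Geometry.Symplectic

/-! ### Elementary pieces -/

section Elementary

/-- `sign d = (-1)^k` in `ℤ` from `d / |d| = (-1)^k` in `ℝ`. [folklore] -/
theorem sign_eq_neg_one_pow_of_div_abs {d : ℝ} (hd : d ≠ 0) {k : ℕ} (h : d / |d| = (-1 : ℝ) ^ k) :
    (if 0 < d then (1 : ℤ) else -1) = (-1 : ℤ) ^ k := by
  have hk : (((if 0 < d then (1 : ℤ) else -1 : ℤ)) : ℝ) = (-1 : ℝ) ^ k := by
    rw [← h]
    split_ifs with hp
    · rw [abs_of_pos hp, div_self hd]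
      simp
    · rw [abs_of_neg (lt_of_le_of_ne (not_lt.1 hp) hd), div_neg, div_self hd]
      simp
  exact_mod_cast hk

/-- `dim_ℂ ℂ¹ = 1` for the model fibre of `(TS, j)` over a surface. [folklore] -/
theorem finrank_tangentModel : finrank ℂ (Fin (finrank ℝ (𝔼 2) / 2) → ℂ) = 1 := by
  rw [Module.finrank_fin_fun, finrank_euclideanSpace_fin]

end Elementary

/-! ### `χ(S) = 2 - b₁(S)` and the Morse count over the critical points -/

section Euler

variable {S : Type} [TopologicalSpace S] [T2Space S] [CompactSpace S] [ChartedSpace (𝔼 2) S]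

/-- **`χ(S) = 2 - rank H₁(S; ℤ)` for a closed connected `ℤ`-oriented surface** (Hatcher 2002,
Thm. 3.26 with App. A: `H_•` finitely generated, `H₀ ≅ ℤ ≅ H₂`, `H_{≥3} = 0`).  (The same computation
as `finRelHomology_and_relEuler_surface` in `Barriers/SmoothPoincare4/SmallExoticaFrontierReductionLemma8Proofs`,
repeated here so that this file does not import a barrier catalogue.) [cite: HatcherAT2002, Thm. 3.26 (a)] -/
theorem relEuler_surface_eq_two_sub [ConnectedSpace S] (μ : HomologicalOrientation ℤ S 2) :
    relEuler ℤ ℤ S ∅ = 2 - (finrank ℤ (singularHomology ℤ ℤ S 1) : ℤ) := by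
  have h : FinRelHomology ℤ ℤ S ∅ 3 :=
    FinRelHomology.empty_of_absolute (fun k => finite_singularHomology_of_compactSpace_holds ℤ S 2 k)
      (fun _ hk => isZero_singularHomology_of_lt_holds ℤ ℤ S 2 (by omega))
  haveI := ChartedSpace.locallyPathConnectedSpace (𝔼 2) S
  haveI : PathConnectedSpace S := pathConnectedSpace_iff_connectedSpace.mpr inferInstance
  have h0 : finrank ℤ (singularHomology ℤ ℤ S 0) = 1 := by
    rw [finrank_singularHomology_zero_of_pathConnectedSpace ℤ ℤ, Module.finrank_self]
  have h2 : finrank ℤ (singularHomology ℤ ℤ S 2) = 1 := by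
    obtain ⟨e⟩ := nonempty_singularHomology_top_iso_holds (R := ℤ) (X := S) 2 μ
    rw [e.toLinearEquiv.finrank_eq, (ULift.moduleEquiv : ULift.{0} ℤ ≃ₗ[ℤ] ℤ).finrank_eq, Module.finrank_self]
  rw [h.relEuler_empty_eq_sum]
  simp only [Finset.sum_range_succ, Finset.sum_range_zero, h0, h2]
  push_cast
  ring

variable [IsManifold (𝓡 2) ∞ S] [SecondCountableTopology S]

/-- **The Morse count of a closed surface as a sum over the critical points**, in `ℤ`:
`Σ_{p critical} (-1)^{ind_p f} = χ(S)` (regrouping `morseCount_eq_relEuler` by the value of the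
index, which is `≤ 2`). [cite: Milnor1963, §5 Thm. 5.2 with §3] -/
theorem sum_neg_one_pow_morseIndex_eq_relEuler_int {f : S → ℝ} (hf : IsMorse (𝓡 2) f)
    (hfin : (criticalSet (𝓡 2) f).Finite) :
    ∑ p ∈ hfin.toFinset, (-1 : ℤ) ^ morseIndex (𝓡 2) f p = relEuler ℤ ℤ S ∅ := by
  classical
  rw [← SphereMorseCount.morseCount_eq_relEuler (n := 1) hf]
  have hmaps : ∀ p ∈ hfin.toFinset, morseIndex (𝓡 2) f p ∈ Finset.range (1 + 2) := by
    intro p _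
    rw [Finset.mem_range]
    have := morseIndex_le_finrank (𝓡 2) f p
    rw [finrank_euclideanSpace_fin] at this
    omega
  rw [← Finset.sum_fiberwise_of_maps_to' hmaps (fun k ↦ (-1 : ℤ) ^ k)]
  refine Finset.sum_congr rfl fun k _ ↦ ?_
  rw [Finset.sum_const, nsmul_eq_mul, mul_comm]
  congr 1
  have hset : criticalSetOfIndex (𝓡 2) f k = ↑(hfin.toFinset.filter fun p ↦ morseIndex (𝓡 2) f p = k) := by
    ext p
    simp only [mem_criticalSetOfIndex, Finset.coe_filter, Set.Finite.mem_toFinset, mem_criticalSet, mem_setOf_eq]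
  rw [hset, Set.ncard_coe_finset]

end Euler

/-! ### The local index of the section of `(TS, j)` attached to a vector field -/

section LocalIndex

variable {S : Type} [TopologicalSpace S] [ChartedSpace (𝔼 2) S] [IsManifold (𝓡 2) ∞ S]
  (j : AlmostComplexStructure (𝓡 2) ∞ S)

/-- **`(TS, j)` is a line bundle.** [cite: McDuffSalamon2017, §2.6] -/
theorem rank_complexTangentBundle_surface : j.complexTangentBundle.rank = 1 := by
  rw [AlmostComplexStructure.rank_complexTangentBundle, finrank_euclideanSpace_fin]

/-- `dim_ℂ` of the model fibre of `(TS, j)` is `1`. [folklore] -/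
theorem finrank_complexTangentBundle_F : finrank ℂ j.complexTangentBundle.F = 1 :=
  j.complexTangentBundle.finrank_of_rank_one (rank_complexTangentBundle_surface j)

/-- **The section of the line bundle `(TS, j)` attached to a vector field `Y`** (`x ↦ β_x (Y x)`,
typed over the bundled `j.complexTangentBundle`). [cite: McDuffSalamon2017, Thm. 2.7.5] -/
def tangentSection (Y : Π x : S, TangentSpace (𝓡 2) x) : ∀ b, j.complexTangentBundle.E b :=
  fun b ↦ (j.fieldSection Y b : j.complexTangentBundle.E b)

/-- The section is continuous for a continuous field. [folklore] -/
theorem continuous_tangentSection {Y : Π x : S, TangentSpace (𝓡 2) x}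
    (hY : Continuous fun x ↦ (⟨x, Y x⟩ : TangentBundle (𝓡 2) S)) :
    Continuous fun b ↦ (⟨b, tangentSection j Y b⟩ : TotalSpace j.complexTangentBundle.F j.complexTangentBundle.E) :=
  j.continuous_fieldSection hY

/-- The zeros of the section are the zeros of the field. [folklore] -/
theorem mem_zeroSet_tangentSection_iff (Y : Π x : S, TangentSpace (𝓡 2) x) (x : S) :
    x ∈ zeroSet (tangentSection j Y) ↔ Y x = 0 := by
  rw [mem_zeroSet_iff]
  exact j.fieldSection_eq_zero_iff Y x

/-- **The local index of `β(Y)` at a non-degenerate zero of the field `Y`**, for `j` tamed by the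
nondegenerate `2`-form `t` and the area orientation `μ_t`: `ind_p = sign det(L_p) · κ(μE)`, `L_p` the
derivative at `φ p` of the chart representative of `Y` (McDuff–Salamon Thm. 2.7.5: the zeros count
with the sign of the Jacobian; the unit `κ(μE) = ±1` is the tree's normalisation of Thom class vs
reference orientation, `lineIndexUnit`). [cite: McDuffSalamon2017, Thm. 2.7.5] -/
theorem localIndex_tangentSection_eq [T2Space S] [CompactSpace S] {t : MForm (𝓡 2) S ℝ 2} (ht : IsSmoothForm t)
    (hnd : ∀ y (v : TangentSpace (𝓡 2) y), v ≠ 0 → ∃ w : TangentSpace (𝓡 2) y, t y ![v, w] ≠ 0)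
    (hJ : j.IsTamedBy t) {Y : Π x : S, TangentSpace (𝓡 2) x}
    (hY : Continuous fun x ↦ (⟨x, Y x⟩ : TangentBundle (𝓡 2) S)) (p : S) (hY0 : Y p = 0)
    (hU : IsOpen (indexDomain (tangentSection j Y) p)) {Lp : (𝔼 2) →L[ℝ] 𝔼 2}
    (hLp : HasFDerivAt (vectorRep (𝓡 2) p Y) Lp (extChartAt (𝓡 2) p p))
    (hdet : LinearMap.det (Lp : (𝔼 2) →ₗ[ℝ] 𝔼 2) ≠ 0) :
    localIndex (finrank_complexTangentBundle_F j) ℤ 1 (tangentSection j Y) (continuous_tangentSection j hY)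
        (surfaceOrientation t ht hnd) p =
      (if 0 < LinearMap.det (Lp : (𝔼 2) →ₗ[ℝ] 𝔼 2) then 1 else -1) * lineIndexUnit (μE 2) := by
  set L := j.complexTangentBundle with hLdef
  set hF := finrank_complexTangentBundle_F j
  set s := tangentSection j Y with hsdef
  set hs := continuous_tangentSection j hY
  set e : Trivialization L.F (π L.F L.E) := trivializationAt L.F L.E p with hedef
  have hp : p ∈ e.baseSet := FiberBundle.mem_baseSet_trivializationAt' p
  set c : OpenPartialHomeomorph S (𝔼 2) := chartAt (𝔼 2) p with hcdef
  have hpc : p ∈ c.source := mem_chart_source (𝔼 2) p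
  set o : SmoothOrientation (𝓡 2) S := surfaceSmoothOrientation t ht hnd with hodef
  -- the area orientation at `p` is the chart transport of the reference orientation `μR o p`
  have hμ : (surfaceOrientation t ht hnd).localClass p =
      (chartTransport c c.open_source subset_rfl hpc 2).symm ((μR o p).localClass (c p)) := rfl
  -- the zero
  have hsp : s p = 0 := by
    change j.modelIsoAt p (Y p) = _
    rw [hY0]
    exact map_zero _
  -- the derivative of the local representative: `Λ_p ∘ L_p`
  have hF' : finrank ℂ (Fin (finrank ℝ (𝔼 2) / 2) → ℂ) = 1 := finrank_tangentModel
  have hder : HasFDerivAt (localRep hF s e c)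
      ((tangentPlaneMap j hF' p).comp Lp) (c p) := by
    have h1 := j.hasFDerivAt_localTriv_fieldSection p hY0 hLp
    have h2 := (((lineToPlane : ULift.{0} ℂ ≃L[ℝ] 𝔼 2) : ULift.{0} ℂ →L[ℝ] 𝔼 2).comp
      ((stdEquivR hF' : (Fin (finrank ℝ (𝔼 2) / 2) → ℂ) ≃L[ℝ] ULift.{0} ℂ) :
        (Fin (finrank ℝ (𝔼 2) / 2) → ℂ) →L[ℝ] ULift.{0} ℂ)).hasFDerivAt.comp (extChartAt (𝓡 2) p p) h1
    refine (h2.congr_fderiv ?_).congr_of_eventuallyEq (Eventually.of_forall fun x ↦ rfl)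
    ext v
    rfl
  have hcomp : (((tangentPlaneMap j hF' p).comp Lp : (𝔼 2) →L[ℝ] 𝔼 2) : (𝔼 2) →ₗ[ℝ] 𝔼 2) =
      ((tangentPlaneMap j hF' p : (𝔼 2) →L[ℝ] 𝔼 2) : (𝔼 2) →ₗ[ℝ] 𝔼 2).comp (Lp : (𝔼 2) →ₗ[ℝ] 𝔼 2) := rfl
  have hA : LinearMap.det (((tangentPlaneMap j hF' p).comp Lp : (𝔼 2) →L[ℝ] 𝔼 2) : (𝔼 2) →ₗ[ℝ] 𝔼 2) ≠ 0 := by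
    rw [hcomp, LinearMap.det_comp]
    exact mul_ne_zero (det_tangentPlaneMap_ne_zero j hF' p) hdet
  have key := localIndex_eq_sign_det_mul_lineIndexUnit hF s hs e (surfaceOrientation t ht hnd) p hsp hU hp
    (μR o p) c hpc hμ hder hA
  rw [key, hcomp, LinearMap.det_comp]
  exact sign_mul_lineIndexUnit_μR o p (det_tangentPlaneMap_pos_iff_orientation j hF' ht hnd hJ p)
    (det_tangentPlaneMap_ne_zero j hF' p) hdet

end LocalIndex

/-! ### The theorem -/

section Main

variable {S : Type} [TopologicalSpace S] [T2Space S] [CompactSpace S] [ChartedSpace (𝔼 2) S]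
  [IsManifold (𝓡 2) ∞ S]

/-- **`⟨c₁(TS, j), [S]_{μ_t}⟩ = -κ(μE) · χ(S)`** for the area orientation `μ_t` of a nondegenerate
`2`-form `t` and any `j` tamed by `t` (Poincaré–Hopf through the gradient of a Morse function; module
docstring). [cite: McDuffSalamon2017, Thm. 2.7.1 (normalization) and Thm. 2.7.5 eq. (2.7.1)] -/
theorem kroneckerPairing_chernClass_tangent_surfaceOrientation (t : MForm (𝓡 2) S ℝ 2) (ht : IsSmoothForm t)
    (hnd : ∀ y (v : TangentSpace (𝓡 2) y), v ≠ 0 → ∃ w : TangentSpace (𝓡 2) y, t y ![v, w] ≠ 0)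
    (j : AlmostComplexStructure (𝓡 2) ∞ S) (hJ : j.IsTamedBy t) :
    kroneckerPairing ℤ ℤ S 2 (degCast ℤ (mul_one 2) (chernClassZ j.complexTangentBundle 1))
        (surfaceOrientation t ht hnd).fundamentalClass =
      -(lineIndexUnit (μE 2) * relEuler ℤ ℤ S ∅) := by
  classical
  haveI : SecondCountableTopology S := ChartedSpace.secondCountable_of_sigmaCompact (𝔼 2) S
  set μ := surfaceOrientation t ht hnd with hμdef
  -- ### a metric, a Morse function, its gradient
  obtain ⟨G⟩ := (nonempty_contMDiffRiemannianMetric (M := S) :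
    Nonempty (ContMDiffRiemannianMetric (𝓡 2) ∞ (𝔼 2) (TangentSpace (𝓡 2) : S → Type _)))
  obtain ⟨f, hf⟩ := exists_isMorse_holds 2 S
  have hCfin : (criticalSet (𝓡 2) f).Finite := IsMorse.finite_criticalSet_holds hf
  set Y : Π x : S, TangentSpace (𝓡 2) x := grad (ofRiemannian G) f with hYdef
  have hY : ContMDiff (𝓡 2) ((𝓡 2).prod 𝓘(ℝ, 𝔼 2)) ∞ fun y ↦
      (TotalSpace.mk' (𝔼 2) y (Y y) : TangentBundle (𝓡 2) S) :=
    contMDiff_grad (ofRiemannian G) hf.contMDiff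
  have hY0 : ∀ x, Y x = 0 ↔ IsMCriticalPt (𝓡 2) f x := fun x ↦ by
    rw [hYdef, grad_eq_zero_iff]
    rfl
  -- ### the line bundle `(TS, j)` and its section `β(Y)`
  set L := j.complexTangentBundle with hLdef
  have hL : L.rank = 1 := rank_complexTangentBundle_surface j
  set hF := finrank_complexTangentBundle_F j
  set s := tangentSection j Y with hsdef
  have hs := continuous_tangentSection j hY.continuous
  have hZ : zeroSet s = criticalSet (𝓡 2) f := by
    ext x
    rw [hsdef, mem_zeroSet_tangentSection_iff, hY0, mem_criticalSet]
  have hZfin : (zeroSet s).Finite := by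
    rw [hZ]
    exact hCfin
  -- ### `c₁ = -e` and localisation
  have hc1 : degCast ℤ (mul_one 2) (chernClassZ L 1) = -(eulerClass L.F L.E hF ℤ 1) := by
    rw [chernClassZ_eq, L.chernClassR_one_of_rank_one ℤ hL]
    rfl
  rw [hc1, map_neg, LinearMap.neg_apply, kroneckerPairing_eulerClass_fundamentalClass hF ℤ 1 s hs hZfin μ]
  congr 1
  -- ### the local indices
  have hloc : ∀ p ∈ hZfin.toFinset, localIndex hF ℤ 1 s hs μ p = (-1 : ℤ) ^ morseIndex (𝓡 2) f p * lineIndexUnit (μE 2) := by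
    intro p hp
    rw [Set.Finite.mem_toFinset, hZ, mem_criticalSet] at hp
    obtain ⟨Lp, hLp, hsgn⟩ := exists_linearization_grad G hf hp
    have hT : (extChartAt (𝓡 2) p).target ∈ 𝓝 (extChartAt (𝓡 2) p p) :=
      (isOpen_extChartAt_target p).mem_nhds (mem_extChartAt_target p)
    have hdiff : HasFDerivAt (vectorRep (𝓡 2) p Y) (Lp : (𝔼 2) →L[ℝ] 𝔼 2) (extChartAt (𝓡 2) p p) := by
      rw [← hLp]
      exact (((contDiffOn_vectorRep p hY.contMDiffOn).contDiffAt hT).differentiableAt (by simp)).hasFDerivAt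
    have hdet : LinearMap.det ((Lp : (𝔼 2) →L[ℝ] 𝔼 2) : (𝔼 2) →ₗ[ℝ] 𝔼 2) ≠ 0 :=
      Lp.toLinearEquiv.isUnit_det'.ne_zero
    rw [localIndex_tangentSection_eq j ht hnd hJ hY.continuous p ((hY0 p).2 hp) (isOpen_indexDomain hZfin p)
      hdiff hdet, sign_eq_neg_one_pow_of_div_abs hdet hsgn]
  rw [Finset.sum_congr rfl hloc, ← Finset.sum_mul, mul_comm]
  congr 1
  have hFin : hZfin.toFinset = hCfin.toFinset := by
    ext p
    rw [Set.Finite.mem_toFinset, Set.Finite.mem_toFinset, hZ]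
  rw [hFin]
  exact sum_neg_one_pow_morseIndex_eq_relEuler_int hf hCfin

/-- **`⟨c₁(TS, j), [S]⟩ = χ(S) = 2 - rank H₁(S; ℤ)` for a suitable `ℤ`-orientation of the closed
connected surface `S`, simultaneously for all almost complex structures `j` tamed by the nondegenerate
`2`-form `t`** (McDuff–Salamon 2017, Thm. 2.7.1, normalization axiom `c₁(TΣ) = 2 - 2g`, through the
zero count of Thm. 2.7.5; the orientation is `±` the area orientation of `t`, the sign being the tree's
normalisation unit `κ(μE)`). [cite: McDuffSalamon2017, Thm. 2.7.1 (normalization) and Thm. 2.7.5 eq. (2.7.1)] -/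
theorem exists_orientation_kroneckerPairing_chernClass_tangent_eq [ConnectedSpace S]
    (t : MForm (𝓡 2) S ℝ 2) (ht : IsSmoothForm t)
    (hnd : ∀ y (v : TangentSpace (𝓡 2) y), v ≠ 0 → ∃ w : TangentSpace (𝓡 2) y, t y ![v, w] ≠ 0) :
    ∃ μS : HomologicalOrientation ℤ S 2, ∀ j : AlmostComplexStructure (𝓡 2) ∞ S, j.IsTamedBy t →
      kroneckerPairing ℤ ℤ S 2 (degCast ℤ (mul_one 2) (chernClassZ j.complexTangentBundle 1)) μS.fundamentalClass =
        2 - (finrank ℤ (singularHomology ℤ ℤ S 1) : ℤ) := by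
  set μ := surfaceOrientation t ht hnd with hμdef
  have hχ : relEuler ℤ ℤ S ∅ = 2 - (finrank ℤ (singularHomology ℤ ℤ S 1) : ℤ) := relEuler_surface_eq_two_sub μ
  rcases lineIndexUnit_eq_one_or_eq_neg_one (μE 2) with hκ | hκ
  · refine ⟨-μ, fun j hJ ↦ ?_⟩
    rw [HomologicalOrientation.fundamentalClass_neg_holds (R := ℤ) (X := S) 2 μ, map_neg,
      kroneckerPairing_chernClass_tangent_surfaceOrientation t ht hnd j hJ, hκ, one_mul, neg_neg, hχ]
  · refine ⟨μ, fun j hJ ↦ ?_⟩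
    rw [kroneckerPairing_chernClass_tangent_surfaceOrientation t ht hnd j hJ, hκ, neg_one_mul, neg_neg, hχ]

end Main

end Literature.Geometry.Symplectic
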